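import Summits.QuantumFields.YangMills.Theorems.BalabanUVNodesN08AlphaArgClass
import Summits.QuantumFields.YangMills.Theorems.BalabanUVNodesN08AlphaCompactSel

/-!
# Route «BalabanUVNodes», Track-A DAG node N08 = [Balaban1985UV3] — THE (α) CLAUSE: the selection run INSIDE THE ADAPTED CLASS — the in-edge
# conclusion (b7) holds by construction at every scale, so `InEdgeFaces₃` follows from ONE displayed hypothesis: non-emptiness of [7] (8)'s
# constraint space in the adapted closed class

Cell `pub-ymgap`, seat `pub-ymgap-dag-n08-d` gen 4, file 10 (director-ym R134 row «CLASS-I in-edge conclusions at the (α) granularity of `RunAlpha`»).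
`bears_on: R4∕N08`; filed `--supports stmt-QuantumFields-19903 --as helper`.  Sorry-free, standard axioms.  Builds on files 6 (`…N08AlphaCompactSel`:
closed regular class `regClassC`, constraint space `admB42c`, minimisers by compactness) and 9 (`…N08AlphaArgClass`: the adapted classes `argClass` ∕
`argClassC` — open ∕ closed, `∋ 1`, and ON `argClass 𝔊 k` every lifted `j`-fold average, `j < k`, is continuous).

WHAT THIS FILE PROVES.
* §1 `admB42a … k h … V` — for the run's steps `k ≤ K`: file 6's constraint space `admB42c … V` (open ∧ closed regular class of [7] (2)∕(8), lifted
  averages of [4] prescribed by the `h`-large data on the bonds of `Λ_j(h)`, `j < k`, guarded top clause «V_k = V») intersected with the adapted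
  closed class `argClassC 𝔊 k`; `∅` beyond `K` (never read).  ★ `exists_selector_admB42a`: measurable minimiser selectors over the OPEN class
  `regClass ∩ argClass` — the constraint maps being continuous there BY FILE 9, no hypothesis — and, for `k ≤ K`, a minimiser EXISTS as soon as the
  space is non-empty (closed in the compact configuration space).
* §2 ★ `exists_externalInputs_faces₃_adapted`: for external inputs `X₀` (averaging, regular classes), a continuous objective, `h`-large lift data
  `Vl`, open small-field sets `Sm`, top maps `T` continuous on [7]'s class (e.g. a continuous averaging's `k`-fold iterate) and bonds `Bk`, and the ONE
  displayed hypothesis (b11″) `hne` — for `k ≤ K`, admissible `h`, every `V`: `admB42a … V` is NON-EMPTY — there are external inputs `X` (same `av`,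
  `reg`) whose `U_k(·, h)` are measurable minimiser selections with `InEdgeFaces₃ 𝔊 𝔠 X` (measUk ∧ reg2 ∧ inB42).  With gen 3's closers (file 11) the
  (α) clause's in-edge side is thereby ONE kinematic sentence about [7]'s constraint space.
HONEST FRAMING.  (b11″) is DISPLAYED (it asserts that SOME configuration of [7]'s closed regular class whose iterated `log`-arguments stay `≤ ¼` has the
prescribed block averages — implied by, and much weaker than, [7] Thm 1 with [4] Prop. 2; NOT proved here); nothing of [B10] ∕ [7] ∕ [4]'s estimates is
asserted; count-neutral; NOT a discharge of N08.  d = 3 lattice gauge theory on finite tori as printed; nothing about d = 4, the continuum, OS axioms,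
a mass gap or the Clay problem.
-/

noncomputable section

namespace Summit.QuantumFields.YangMills.Theorems.BalabanUVNodesN08AlphaAdaptedSel

open MeasureTheory Set Topology TopologicalSpace
open scoped Matrix Matrix.Norms.L2Operator
open Literature.MeasureTheory.RandomSets
open Literature.MathematicalPhysics.QuantumFieldTheory.Balaban1983to89
open Literature.MathematicalPhysics.QuantumFieldTheory.Balaban1983to89.B10 (pFun)
open Literature.MathematicalPhysics.QuantumFieldTheory.Balaban1985CMP102.Setting
open Summit.QuantumFields.Balaban3D.Carriers
open Summit.QuantumFields.Balaban3D.Proofs.Primitives (AlphaConsts)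
open Summit.QuantumFields.Balaban3D.Proofs.LiftBridge (liftCfg)
open Summit.QuantumFields.Balaban3D.Proofs.TorusLift (projSite)
open Summit.QuantumFields.YangMills.Theorems.BalabanUVNodesN08AlphaClassI (RegLift InB42Lift HLarge)
open Summit.QuantumFields.YangMills.Theorems.BalabanUVNodesN08AlphaLoop28 (InEdgeFaces₃)
open Summit.QuantumFields.YangMills.Theorems.BalabanUVNodesN08AlphaGroupTopology
open Summit.QuantumFields.YangMills.Theorems.BalabanUVNodesN08AlphaMeasUk
open Summit.QuantumFields.YangMills.Theorems.BalabanUVNodesN08AlphaRegSel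
open Summit.QuantumFields.YangMills.Theorems.BalabanUVNodesN08AlphaInB42Sel
open Summit.QuantumFields.YangMills.Theorems.BalabanUVNodesN08AlphaCompactSel
open Summit.QuantumFields.YangMills.Theorems.BalabanUVNodesN08AlphaArgClass
open B7Prop1Explicit (e)
open B7Prop2Explicit (avgIter)

variable {L : ℕ} {S : Scales L} {G : Type} [GaugeGroup G] [MeasurableSpace G]

/-! ## §1 The constraint space in the adapted closed class; selectors and minimisers -/
section Problem
variable (𝔊 : GroupModel G) (𝔠 : AlphaConsts L 𝔊.N)

open Classical in
/-- **THE (42)-CONSTRAINT SPACE OF [7] (8) IN THE ADAPTED CLOSED CLASS** (steps `k ≤ K`; `∅` beyond, never read): file 6's `admB42c … V` ∩ `argClassC 𝔊 k`.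
[cite: Balaban1985UV3, (42) p.266; Balaban1985Variational, (3)+(6)+(8) pp.278–279; Balaban1985Averaging, (21) p.21] -/
def admB42a (k : ℕ) (h : Hist S.P k) (Vl : ℕ → B7Prop1Explicit.Site S.P.d → Fin S.P.d → (Matrix (Fin 𝔊.N) (Fin 𝔊.N) ℂ)ˣ)
    (Sm : Set (GaugeField S.P k G)) (T : GaugeField S.P 0 G → GaugeField S.P k G) (Bk : Set (PBond S.P k)) (V : GaugeField S.P k G) :
    Set (GaugeField S.P 0 G) :=
  if k ≤ S.K then admB42c 𝔊 𝔠 k h Vl Sm T Bk V ∩ argClassC 𝔊 k else ∅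

/-- On the run's steps the space is file 6's space cut by the adapted closed class. [folklore] -/
theorem admB42a_of_le {k : ℕ} (hk : k ≤ S.K) (h : Hist S.P k) (Vl : ℕ → B7Prop1Explicit.Site S.P.d → Fin S.P.d → (Matrix (Fin 𝔊.N) (Fin 𝔊.N) ℂ)ˣ)
    (Sm : Set (GaugeField S.P k G)) (T : GaugeField S.P 0 G → GaugeField S.P k G) (Bk : Set (PBond S.P k)) (V : GaugeField S.P k G) :
    admB42a 𝔊 𝔠 k h Vl Sm T Bk V = admB42c 𝔊 𝔠 k h Vl Sm T Bk V ∩ argClassC 𝔊 k := by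
  unfold admB42a
  rw [if_pos hk]

/-- Beyond the run's steps the space is empty. [folklore] -/
theorem admB42a_of_not {k : ℕ} (hk : ¬ k ≤ S.K) (h : Hist S.P k) (Vl : ℕ → B7Prop1Explicit.Site S.P.d → Fin S.P.d → (Matrix (Fin 𝔊.N) (Fin 𝔊.N) ℂ)ˣ)
    (Sm : Set (GaugeField S.P k G)) (T : GaugeField S.P 0 G → GaugeField S.P k G) (Bk : Set (PBond S.P k)) (V : GaugeField S.P k G) :
    admB42a 𝔊 𝔠 k h Vl Sm T Bk V = ∅ := by
  unfold admB42a
  rw [if_neg hk]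

/-- The run's steps are within the periodicity range of the tower (`K ≤ m + K + 1`). [folklore] -/
theorem le_period_bound {k : ℕ} (hk : k ≤ S.K) : k ≤ S.P.m + S.P.K + 1 := by
  have : S.P.K = S.K := rfl
  omega

/-- **★ SELECTORS AND MINIMISERS FOR THE CONSTRAINT SPACE IN THE ADAPTED CLASS — NO CONTINUITY HYPOTHESIS ON THE AVERAGES.**  For every step `k` and
history `h`: (i)–(ii) a measurable `f` selecting a minimiser of `A` on `admB42a … V` wherever one exists, `1` elsewhere — the selection of file 3 §1 over the
OPEN class `regClass 𝔊 𝔠 k h ∩ argClass 𝔊 k`, on which the lifted averages are continuous BY FILE 9 (`continuousOn_val_liftAvg_argClass`); (iii) for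
`k ≤ K` a minimiser EXISTS as soon as the space is non-empty (it is closed in the compact configuration space).  Only the top map `T` is asked to be
continuous on [7]'s class. [cite: Balaban1985UV3, (42) p.266; Balaban1985Variational, Thm 1 (8) p.279 (existence half by compactness; measurable-selection reading)] -/
theorem exists_selector_admB42a (k : ℕ) (h : Hist S.P k)
    (Vl : ℕ → B7Prop1Explicit.Site S.P.d → Fin S.P.d → (Matrix (Fin 𝔊.N) (Fin 𝔊.N) ℂ)ˣ)
    {Sm : Set (GaugeField S.P k G)} (hSm : letI := rhoTopology 𝔊; IsOpen Sm)
    (T : GaugeField S.P 0 G → GaugeField S.P k G) (Bk : Set (PBond S.P k))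
    (hT : letI := rhoTopology 𝔊; ContinuousOn T (regClass 𝔊 𝔠 k h))
    {A : GaugeField S.P 0 G → ℝ} (hA : letI := rhoTopology 𝔊; Continuous A) :
    (∃ f : GaugeField S.P k G → GaugeField S.P 0 G, Measurable f ∧
      (∀ V, (∃ U ∈ admB42a 𝔊 𝔠 k h Vl Sm T Bk V, IsMinOn A (admB42a 𝔊 𝔠 k h Vl Sm T Bk V) U) →
        f V ∈ admB42a 𝔊 𝔠 k h Vl Sm T Bk V ∧ IsMinOn A (admB42a 𝔊 𝔠 k h Vl Sm T Bk V) (f V)) ∧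
      (∀ V, ¬ (∃ U ∈ admB42a 𝔊 𝔠 k h Vl Sm T Bk V, IsMinOn A (admB42a 𝔊 𝔠 k h Vl Sm T Bk V) U) → f V = 1)) ∧
    (k ≤ S.K → ∀ V, (admB42a 𝔊 𝔠 k h Vl Sm T Bk V).Nonempty →
      ∃ U ∈ admB42a 𝔊 𝔠 k h Vl Sm T Bk V, IsMinOn A (admB42a 𝔊 𝔠 k h Vl Sm T Bk V) U) := by
  classical
  by_cases hk : k ≤ S.K
  swap
  · -- beyond the run's steps: the space is empty, the constant selector `1` does
    refine ⟨⟨fun _ => 1, measurable_const, fun V hV => ?_, fun V _ => rfl⟩, fun hk' => absurd hk' hk⟩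
    obtain ⟨U, hU, -⟩ := hV
    rw [admB42a_of_not 𝔊 𝔠 hk] at hU
    exact absurd hU (Set.notMem_empty U)
  have hkb : k ≤ S.P.m + S.P.K + 1 := le_period_bound hk
  letI := rhoTopology 𝔊
  haveI := secondCountableTopology_rho 𝔊
  haveI := borelSpace_rho 𝔊
  haveI : T2Space G := (isEmbedding_rho 𝔊).t2Space
  haveI : SecondCountableTopology (GaugeField S.P k G) := inferInstanceAs (SecondCountableTopology (PBond S.P k → G))
  haveI : BorelSpace (GaugeField S.P k G) := inferInstanceAs (BorelSpace (PBond S.P k → G))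
  haveI : SecondCountableTopology (GaugeField S.P 0 G) := inferInstanceAs (SecondCountableTopology (PBond S.P 0 → G))
  haveI : BorelSpace (GaugeField S.P 0 G) := inferInstanceAs (BorelSpace (PBond S.P 0 → G))
  letI : MeasurableSpace (Matrix (Fin 𝔊.N) (Fin 𝔊.N) ℂ) := borel _
  haveI : BorelSpace (Matrix (Fin 𝔊.N) (Fin 𝔊.N) ℂ) := ⟨rfl⟩
  haveI : SecondCountableTopology (Matrix (Fin 𝔊.N) (Fin 𝔊.N) ℂ) := secondCountableTopology_matrix (n := Fin 𝔊.N)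
  haveI : SecondCountableTopology (B7Prop1Explicit.Site S.P.d → Fin S.P.d → Matrix (Fin 𝔊.N) (Fin 𝔊.N) ℂ) := inferInstance
  haveI : SecondCountableTopology (Fin k → B7Prop1Explicit.Site S.P.d → Fin S.P.d → Matrix (Fin 𝔊.N) (Fin 𝔊.N) ℂ) := inferInstance
  haveI : BorelSpace (Fin k → B7Prop1Explicit.Site S.P.d → Fin S.P.d → Matrix (Fin 𝔊.N) (Fin 𝔊.N) ℂ) := inferInstance
  letI instT1 : TopologicalSpace ((Fin k → B7Prop1Explicit.Site S.P.d → Fin S.P.d → Matrix (Fin 𝔊.N) (Fin 𝔊.N) ℂ) × GaugeField S.P k G) := inferInstance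
  letI instM1 : MeasurableSpace ((Fin k → B7Prop1Explicit.Site S.P.d → Fin S.P.d → Matrix (Fin 𝔊.N) (Fin 𝔊.N) ℂ) × GaugeField S.P k G) := inferInstance
  haveI : OpensMeasurableSpace ((Fin k → B7Prop1Explicit.Site S.P.d → Fin S.P.d → Matrix (Fin 𝔊.N) (Fin 𝔊.N) ℂ) × GaugeField S.P k G) := inferInstance
  haveI : SecondCountableTopology ((Fin k → B7Prop1Explicit.Site S.P.d → Fin S.P.d → Matrix (Fin 𝔊.N) (Fin 𝔊.N) ℂ) × GaugeField S.P k G) :=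
    inferInstance
  letI instT2 : TopologicalSpace (((Fin k → B7Prop1Explicit.Site S.P.d → Fin S.P.d → Matrix (Fin 𝔊.N) (Fin 𝔊.N) ℂ) × GaugeField S.P k G) × GaugeField S.P 0 G) :=
    inferInstance
  letI instM2 : MeasurableSpace (((Fin k → B7Prop1Explicit.Site S.P.d → Fin S.P.d → Matrix (Fin 𝔊.N) (Fin 𝔊.N) ℂ) × GaugeField S.P k G) × GaugeField S.P 0 G) :=
    inferInstance
  haveI : OpensMeasurableSpace (((Fin k → B7Prop1Explicit.Site S.P.d → Fin S.P.d → Matrix (Fin 𝔊.N) (Fin 𝔊.N) ℂ) × GaugeField S.P k G) × GaugeField S.P 0 G) :=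
    inferInstance
  letI : TopologicalSpace ((((Fin k → B7Prop1Explicit.Site S.P.d → Fin S.P.d → Matrix (Fin 𝔊.N) (Fin 𝔊.N) ℂ) × GaugeField S.P k G) ×
      GaugeField S.P 0 G) × (((Fin k → B7Prop1Explicit.Site S.P.d → Fin S.P.d → Matrix (Fin 𝔊.N) (Fin 𝔊.N) ℂ) × GaugeField S.P k G) ×
      GaugeField S.P 0 G)) := inferInstance
  -- the open selection class: [7]'s class ∩ the adapted class
  have hO : IsOpen (regClass 𝔊 𝔠 k h ∩ argClass 𝔊 k) := (isOpen_regClass 𝔊 𝔠 k h).inter (isOpen_argClass 𝔊 k hkb)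
  have hC : IsClosed (regClassC 𝔊 𝔠 k h ∩ argClassC 𝔊 k) := (isClosed_regClassC 𝔊 𝔠 k h).inter (isClosed_argClassC 𝔊 k hkb)
  have hsub : regClassC 𝔊 𝔠 k h ∩ argClassC 𝔊 k ⊆ regClass 𝔊 𝔠 k h ∩ argClass 𝔊 k :=
    Set.inter_subset_inter (regClassC_subset_regClass 𝔊 𝔠 hk h) (argClassC_subset_argClass 𝔊 k)
  let g : GaugeField S.P 0 G → ((Fin k → B7Prop1Explicit.Site S.P.d → Fin S.P.d → Matrix (Fin 𝔊.N) (Fin 𝔊.N) ℂ) × GaugeField S.P k G) ×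
      GaugeField S.P 0 G :=
    fun U => ((fun j z κ => ((avgIter L (liftCfg 𝔊 U) (j : ℕ) z κ : (Matrix (Fin 𝔊.N) (Fin 𝔊.N) ℂ)ˣ) : Matrix (Fin 𝔊.N) (Fin 𝔊.N) ℂ), T U), U)
  let π : GaugeField S.P k G → ((Fin k → B7Prop1Explicit.Site S.P.d → Fin S.P.d → Matrix (Fin 𝔊.N) (Fin 𝔊.N) ℂ) × GaugeField S.P k G) ×
      GaugeField S.P 0 G :=
    fun V => ((fun j z κ => ((Vl (j : ℕ) z κ : (Matrix (Fin 𝔊.N) (Fin 𝔊.N) ℂ)ˣ) : Matrix (Fin 𝔊.N) (Fin 𝔊.N) ℂ), V), 1)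
  let R₁ : Set ((((Fin k → B7Prop1Explicit.Site S.P.d → Fin S.P.d → Matrix (Fin 𝔊.N) (Fin 𝔊.N) ℂ) × GaugeField S.P k G) ×
      GaugeField S.P 0 G) × (((Fin k → B7Prop1Explicit.Site S.P.d → Fin S.P.d → Matrix (Fin 𝔊.N) (Fin 𝔊.N) ℂ) × GaugeField S.P k G) ×
      GaugeField S.P 0 G)) :=
    {p | ∀ (j : Fin k) (z : B7Prop1Explicit.Site S.P.d) (κ : Fin S.P.d),
      projSite (((L : ℤ) ^ (j : ℕ)) • z) ∈ Lam 𝔠.lane.carrier.M₁ (rcolOf S 𝔠.lane.carrier) h j →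
      projSite (((L : ℤ) ^ (j : ℕ)) • (z + e κ)) ∈ Lam 𝔠.lane.carrier.M₁ (rcolOf S 𝔠.lane.carrier) h j →
        p.1.1.1 j z κ = p.2.1.1 j z κ}
  let R₂ : Set ((((Fin k → B7Prop1Explicit.Site S.P.d → Fin S.P.d → Matrix (Fin 𝔊.N) (Fin 𝔊.N) ℂ) × GaugeField S.P k G) ×
      GaugeField S.P 0 G) × (((Fin k → B7Prop1Explicit.Site S.P.d → Fin S.P.d → Matrix (Fin 𝔊.N) (Fin 𝔊.N) ℂ) × GaugeField S.P k G) ×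
      GaugeField S.P 0 G)) :=
    {p | p.2.1.2 ∈ Sm → ∀ b ∈ Bk, p.1.1.2 b = p.2.1.2 b}
  let R₃ : Set ((((Fin k → B7Prop1Explicit.Site S.P.d → Fin S.P.d → Matrix (Fin 𝔊.N) (Fin 𝔊.N) ℂ) × GaugeField S.P k G) ×
      GaugeField S.P 0 G) × (((Fin k → B7Prop1Explicit.Site S.P.d → Fin S.P.d → Matrix (Fin 𝔊.N) (Fin 𝔊.N) ℂ) × GaugeField S.P k G) ×
      GaugeField S.P 0 G)) :=
    {p | p.1.2 ∈ regClassC 𝔊 𝔠 k h ∩ argClassC 𝔊 k}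
  let R := R₁ ∩ R₂ ∩ R₃
  have hπ : Measurable π := (measurable_const.prodMk measurable_id).prodMk measurable_const
  have hg : ContinuousOn g (regClass 𝔊 𝔠 k h ∩ argClass 𝔊 k) := by
    refine ContinuousOn.prodMk (ContinuousOn.prodMk ?_ (hT.mono Set.inter_subset_left)) continuousOn_id
    refine continuousOn_pi.mpr fun j => continuousOn_pi.mpr fun z => continuousOn_pi.mpr fun κ => ?_
    exact (continuousOn_val_liftAvg_argClass 𝔊 j.2 z κ).mono Set.inter_subset_right
  have hcoordl : ∀ (j : Fin k) (z : B7Prop1Explicit.Site S.P.d) (κ : Fin S.P.d), Continuous fun p :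
      ((Fin k → B7Prop1Explicit.Site S.P.d → Fin S.P.d → Matrix (Fin 𝔊.N) (Fin 𝔊.N) ℂ) × GaugeField S.P k G) × GaugeField S.P 0 G => p.1.1 j z κ :=
    fun j z κ => (continuous_apply κ).comp ((continuous_apply z).comp ((continuous_apply j).comp (continuous_fst.comp continuous_fst)))
  have hcoordk : ∀ b : PBond S.P k, Continuous fun p :
      ((Fin k → B7Prop1Explicit.Site S.P.d → Fin S.P.d → Matrix (Fin 𝔊.N) (Fin 𝔊.N) ℂ) × GaugeField S.P k G) × GaugeField S.P 0 G => p.1.2 b :=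
    fun b => (show Continuous fun V : GaugeField S.P k G => V b from continuous_apply b).comp (continuous_snd.comp continuous_fst)
  have hR₁ : IsClosed R₁ := by
    simp only [R₁, setOf_forall]
    refine isClosed_iInter fun j => isClosed_iInter fun z => isClosed_iInter fun κ => isClosed_iInter fun _ => isClosed_iInter fun _ => ?_
    exact isClosed_eq ((hcoordl j z κ).comp continuous_fst) ((hcoordl j z κ).comp continuous_snd)
  have hR₂ : IsClosed R₂ := by
    have hset : R₂ = {p | p.2.1.2 ∉ Sm} ∪ ⋂ b ∈ Bk, {p | p.1.1.2 b = p.2.1.2 b} := by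
      ext p
      simp only [R₂, mem_setOf_eq, mem_union, mem_iInter]
      exact ⟨fun hp => (em (p.2.1.2 ∈ Sm)).elim (fun hs => Or.inr (hp hs)) Or.inl, fun hp hs => hp.elim (fun hn => absurd hs hn) id⟩
    rw [hset]
    refine IsClosed.union ?_ (isClosed_biInter fun b _ => isClosed_eq ((hcoordk b).comp continuous_fst) ((hcoordk b).comp continuous_snd))
    exact (hSm.isClosed_compl).preimage ((continuous_snd.comp continuous_fst).comp continuous_snd)
  have hR₃ : IsClosed R₃ := hC.preimage (continuous_snd.comp continuous_fst)
  have hR : IsClosed R := (hR₁.inter hR₂).inter hR₃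
  have hadm : ∀ (U : GaugeField S.P 0 G) (V : GaugeField S.P k G),
      (U ∈ regClass 𝔊 𝔠 k h ∩ argClass 𝔊 k ∧ (g U, π V) ∈ R) ↔ U ∈ admB42a 𝔊 𝔠 k h Vl Sm T Bk V := by
    intro U V
    rw [admB42a_of_le 𝔊 𝔠 hk]
    simp only [admB42c, admB42, mem_inter_iff, mem_setOf_eq, R, R₁, R₂, R₃, g, π, InB42Lift]
    constructor
    · rintro ⟨⟨hU, -⟩, ⟨hl, hk'⟩, hC', hA'⟩
      exact ⟨⟨⟨hU, fun j hj z κ h1 h2 => Units.val_injective (hl ⟨j, hj⟩ z κ h1 h2), hk'⟩, hC'⟩, hA'⟩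
    · rintro ⟨⟨⟨hU, hl, hk'⟩, hC'⟩, hA'⟩
      exact ⟨⟨hU, argClassC_subset_argClass 𝔊 k hA'⟩, ⟨fun j z κ h1 h2 => congrArg Units.val (hl j j.2 z κ h1 h2), hk'⟩, hC', hA'⟩
  obtain ⟨f, hfm, hfin, hfout⟩ :=
    exists_measurable_constrainedMin_rho_of_continuousOn 𝔊 (i := 0) hπ hO hg hR hA 1
  refine ⟨⟨f, hfm, fun V hV => ?_, fun V hV => ?_⟩, fun _ V hne => ?_⟩
  · obtain ⟨U₀, hU₀, hmin⟩ := hV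
    have hex : ∃ U, (U ∈ regClass 𝔊 𝔠 k h ∩ argClass 𝔊 k ∧ (g U, π V) ∈ R) ∧
        ∀ U', U' ∈ regClass 𝔊 𝔠 k h ∩ argClass 𝔊 k ∧ (g U', π V) ∈ R → A U ≤ A U' :=
      ⟨U₀, (hadm U₀ V).mpr hU₀, fun U' hU' => hmin ((hadm U' V).mp hU')⟩
    obtain ⟨hf₁, hf₂⟩ := hfin V hex
    exact ⟨(hadm (f V) V).mp hf₁, fun U' hU' => hf₂ U' ((hadm U' V).mpr hU')⟩
  · refine hfout V fun h' => hV ?_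
    obtain ⟨U₀, hU₀, hmin⟩ := h'
    exact ⟨U₀, (hadm U₀ V).mp hU₀, fun U' hU' => hmin U' ((hadm U' V).mpr hU')⟩
  · -- (iii) existence by compactness
    haveI := compactSpace_rho 𝔊
    haveI : CompactSpace (GaugeField S.P 0 G) := inferInstanceAs (CompactSpace (PBond S.P 0 → G))
    have hRV : IsClosed {z | (z, π V) ∈ R} := hR.preimage (continuous_id.prodMk continuous_const)
    have hcl : IsClosed ((regClassC 𝔊 𝔠 k h ∩ argClassC 𝔊 k) ∩ g ⁻¹' {z | (z, π V) ∈ R}) :=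
      (hg.mono hsub).preimage_isClosed_of_isClosed hC hRV
    have hset : admB42a 𝔊 𝔠 k h Vl Sm T Bk V = (regClassC 𝔊 𝔠 k h ∩ argClassC 𝔊 k) ∩ g ⁻¹' {z | (z, π V) ∈ R} := by
      ext U
      constructor
      · intro hU
        have hU' := hU
        rw [admB42a_of_le 𝔊 𝔠 hk] at hU'
        exact ⟨⟨hU'.1.2, hU'.2⟩, ((hadm U V).mpr hU).2⟩
      · rintro ⟨hC', hUR⟩
        exact (hadm U V).mp ⟨hsub hC', hUR⟩
    rw [hset] at hne ⊢
    exact hcl.isCompact.exists_isMinOn hne hA.continuousOn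
/-- **NON-VACUITY AT THE TRIVIAL HISTORY**: with no large fields (`Λ_j(triv) = ∅`, tree `Omega_triv`) and no top clause at `V` (`V ∉ Sm`), the unit
configuration lies in the constraint space — so (b11″) is automatic there; its content is at the non-trivial histories. [cite: Balaban1985UV3, (42) p.266 + p.267 «the only term of (47)»] -/
theorem one_mem_admB42a_triv {k : ℕ} (hk : k ≤ S.K) (Vl : ℕ → B7Prop1Explicit.Site S.P.d → Fin S.P.d → (Matrix (Fin 𝔊.N) (Fin 𝔊.N) ℂ)ˣ)
    (Sm : Set (GaugeField S.P k G)) (T : GaugeField S.P 0 G → GaugeField S.P k G) (Bk : Set (PBond S.P k)) {V : GaugeField S.P k G}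
    (hV : V ∉ Sm) : (1 : GaugeField S.P 0 G) ∈ admB42a 𝔊 𝔠 k (Hist.triv S.P k) Vl Sm T Bk V := by
  rw [admB42a_of_le 𝔊 𝔠 hk]
  refine ⟨⟨⟨one_mem_regClass 𝔊 𝔠 k hk _, fun j _ z κ h1 _ => ?_, fun hs => absurd hs hV⟩, one_mem_regClassC 𝔊 𝔠 hk _⟩, one_mem_argClassC 𝔊 k⟩
  simp [Lam, Omega_triv] at h1
end Problem

/-! ## §2 `InEdgeFaces₃` from ONE hypothesis: non-emptiness of the constraint space in the adapted class -/
section Faces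
variable [HaarData G] (𝔊 : GroupModel G) (𝔠 : AlphaConsts L 𝔊.N)

/-- **★ `InEdgeFaces₃` FROM NON-EMPTINESS ALONE.**  Data: `X₀`, a continuous objective `A`, `h`-large lift data `Vl`, open small-field sets `Sm`, top maps
`T k` continuous on [7]'s class, bonds `Bk`.  ONE displayed hypothesis (b11″) `hne`: for `k ≤ K`, admissible `h`, every `V`, the constraint space
`admB42a … V` ([7] (8) in the closed regular class, lifted averages prescribed on `Λ_j(h)`, guarded top clause, iterated `log`-arguments `≤ ¼`) is
NON-EMPTY.  Conclusion: external inputs `X` (same `av`, `reg`) whose `U_k(·, h)` are measurable minimiser selections, with (i) `measUk` for all `k, h`,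
(ii) `reg2` for all `k ≤ K`, (iii) minimality in the constraint space at admissible histories, (iv) `InEdgeFaces₃ 𝔊 𝔠 X`.
[cite: Balaban1985UV3, (42) p.266 + (67)–(68) p.273; Balaban1985Variational, (2)+(3)+(8) pp.278–279, Thm 1 p.279; Balaban1985Averaging, (21) p.21 + (42)–(43) pp.23–24] -/
theorem exists_externalInputs_faces₃_adapted (X₀ : ExternalInputs S G) {A : GaugeField S.P 0 G → ℝ}
    (hA : letI := rhoTopology 𝔊; Continuous A)
    (Vl : (k : ℕ) → Hist S.P k → ℕ → B7Prop1Explicit.Site S.P.d → Fin S.P.d → (Matrix (Fin 𝔊.N) (Fin 𝔊.N) ℂ)ˣ)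
    (hVl : ∀ (k : ℕ) (h : Hist S.P k), HLarge S 𝔠.lane.carrier.b₀ 𝔠.lane.carrier.p₀ h (Vl k h))
    (Sm : (k : ℕ) → Hist S.P k → Set (GaugeField S.P k G)) (hSm : letI := rhoTopology 𝔊; ∀ k h, IsOpen (Sm k h))
    (T : (k : ℕ) → GaugeField S.P 0 G → GaugeField S.P k G) (Bk : (k : ℕ) → Hist S.P k → Set (PBond S.P k))
    (hT : letI := rhoTopology 𝔊; ∀ (k : ℕ) (h : Hist S.P k), ContinuousOn (T k) (regClass 𝔊 𝔠 k h))
    (hne : ∀ k, k ≤ S.K → ∀ (h : Hist S.P k), Hist.Admissible 𝔠.lane.carrier.M₁ (rcolOf S 𝔠.lane.carrier) k h →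
      ∀ (V : GaugeField S.P k G), (admB42a 𝔊 𝔠 k h (Vl k h) (Sm k h) (T k) (Bk k h) V).Nonempty) :
    ∃ X : ExternalInputs S G, X.av = X₀.av ∧ X.reg = X₀.reg ∧
      (∀ (k : ℕ) (h : Hist S.P k), Measurable (X.UkH k h)) ∧
      (∀ k, k ≤ S.K → ∀ (h : Hist S.P k) (U : GaugeField S.P k G), ∀ j < k,
        RegLift S j (Omega 𝔠.lane.carrier.M₁ (rcolOf S 𝔠.lane.carrier) k h j)
          (𝔠.C68 * (S.gk j * pFun 𝔠.lane.carrier.b₀ 𝔠.lane.carrier.p₀ (S.gk j))) (liftCfg 𝔊 (X.UkH k h U))) ∧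
      (∀ k, k ≤ S.K → ∀ (h : Hist S.P k), Hist.Admissible 𝔠.lane.carrier.M₁ (rcolOf S 𝔠.lane.carrier) k h → h ≠ Hist.triv S.P k →
        ∀ (U : GaugeField S.P k G), X.UkH k h U ∈ admB42a 𝔊 𝔠 k h (Vl k h) (Sm k h) (T k) (Bk k h) U ∧
          IsMinOn A (admB42a 𝔊 𝔠 k h (Vl k h) (Sm k h) (T k) (Bk k h) U) (X.UkH k h U)) ∧
      (∀ k, k + 1 ≤ S.K → Hist.Admissible 𝔠.lane.carrier.M₁ (rcolOf S 𝔠.lane.carrier) (k + 1) (Hist.triv S.P (k + 1)) →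
        ∀ (U : GaugeField S.P (k + 1) G),
          X.Uk k U ∈ admB42a 𝔊 𝔠 (k + 1) (Hist.triv S.P (k + 1)) (Vl (k + 1) (Hist.triv S.P (k + 1))) (Sm (k + 1) (Hist.triv S.P (k + 1)))
              (T (k + 1)) (Bk (k + 1) (Hist.triv S.P (k + 1))) U ∧
            IsMinOn A (admB42a 𝔊 𝔠 (k + 1) (Hist.triv S.P (k + 1)) (Vl (k + 1) (Hist.triv S.P (k + 1))) (Sm (k + 1) (Hist.triv S.P (k + 1)))
              (T (k + 1)) (Bk (k + 1) (Hist.triv S.P (k + 1))) U) (X.Uk k U)) ∧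
      InEdgeFaces₃ 𝔊 𝔠 X := by
  obtain ⟨X, hav, hreg, hm, hmin, hminT, hout, houtT⟩ := exists_externalInputs_of_selectors X₀ A
    (fun k h V => admB42a 𝔊 𝔠 k h (Vl k h) (Sm k h) (T k) (Bk k h) V)
    (fun k h => (exists_selector_admB42a 𝔊 𝔠 k h (Vl k h) (hSm k h) (T k) (Bk k h) (hT k h) hA).1)
  have hsolv : ∀ k, k ≤ S.K → ∀ (h : Hist S.P k), Hist.Admissible 𝔠.lane.carrier.M₁ (rcolOf S 𝔠.lane.carrier) k h →
      ∀ (V : GaugeField S.P k G), ∃ U ∈ admB42a 𝔊 𝔠 k h (Vl k h) (Sm k h) (T k) (Bk k h) V,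
        IsMinOn A (admB42a 𝔊 𝔠 k h (Vl k h) (Sm k h) (T k) (Bk k h) V) U :=
    fun k hk h hh V => (exists_selector_admB42a 𝔊 𝔠 k h (Vl k h) (hSm k h) (T k) (Bk k h) (hT k h) hA).2 hk V (hne k hk h hh V)
  -- membership in the constraint space gives membership in file 6's space, hence in the open regular class
  have hmem : ∀ {k : ℕ} (hk : k ≤ S.K) {h : Hist S.P k} {V : GaugeField S.P k G} {U : GaugeField S.P 0 G},
      U ∈ admB42a 𝔊 𝔠 k h (Vl k h) (Sm k h) (T k) (Bk k h) V → U ∈ admB42c 𝔊 𝔠 k h (Vl k h) (Sm k h) (T k) (Bk k h) V := by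
    intro k hk h V U hU
    rw [admB42a_of_le 𝔊 𝔠 hk] at hU
    exact hU.1
  have hval : ∀ k, k ≤ S.K → ∀ (h : Hist S.P k) (U : GaugeField S.P k G), X.UkH k h U ∈ regClass 𝔊 𝔠 k h := by
    intro k hk h U
    by_cases hh : h = Hist.triv S.P k
    · subst hh
      rw [X.UkH_triv]
      cases k with
      | zero => exact fun j hj => absurd hj (Nat.not_lt_zero j)
      | succ k =>
        show X.Uk k U ∈ regClass 𝔊 𝔠 (k + 1) (Hist.triv S.P (k + 1))
        by_cases hex : ∃ U' ∈ admB42a 𝔊 𝔠 (k + 1) (Hist.triv S.P (k + 1)) (Vl (k + 1) (Hist.triv S.P (k + 1))) (Sm (k + 1) (Hist.triv S.P (k + 1)))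
            (T (k + 1)) (Bk (k + 1) (Hist.triv S.P (k + 1))) U,
            IsMinOn A (admB42a 𝔊 𝔠 (k + 1) (Hist.triv S.P (k + 1)) (Vl (k + 1) (Hist.triv S.P (k + 1))) (Sm (k + 1) (Hist.triv S.P (k + 1)))
              (T (k + 1)) (Bk (k + 1) (Hist.triv S.P (k + 1))) U) U'
        · exact (hmem hk (hminT k U hex).1).1.1
        · rw [houtT k U hex]
          exact one_mem_regClass 𝔊 𝔠 (k + 1) hk _
    · by_cases hex : ∃ U' ∈ admB42a 𝔊 𝔠 k h (Vl k h) (Sm k h) (T k) (Bk k h) U,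
          IsMinOn A (admB42a 𝔊 𝔠 k h (Vl k h) (Sm k h) (T k) (Bk k h) U) U'
      · exact (hmem hk (hmin k h U hh hex).1).1.1
      · rw [hout k h U hh hex]
        exact one_mem_regClass 𝔊 𝔠 k hk h
  have hreg2 : ∀ k, k ≤ S.K → ∀ (h : Hist S.P k) (U : GaugeField S.P k G), ∀ j < k,
      RegLift S j (Omega 𝔠.lane.carrier.M₁ (rcolOf S 𝔠.lane.carrier) k h j)
        (𝔠.C68 * (S.gk j * pFun 𝔠.lane.carrier.b₀ 𝔠.lane.carrier.p₀ (S.gk j))) (liftCfg 𝔊 (X.UkH k h U)) :=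
    fun k hk h U j hj => hval k hk h U j hj
  have hsolN : ∀ k, k ≤ S.K → ∀ (h : Hist S.P k), Hist.Admissible 𝔠.lane.carrier.M₁ (rcolOf S 𝔠.lane.carrier) k h →
      h ≠ Hist.triv S.P k → ∀ (U : GaugeField S.P k G), X.UkH k h U ∈ admB42a 𝔊 𝔠 k h (Vl k h) (Sm k h) (T k) (Bk k h) U ∧
        IsMinOn A (admB42a 𝔊 𝔠 k h (Vl k h) (Sm k h) (T k) (Bk k h) U) (X.UkH k h U) :=
    fun k hk h hh ht U => hmin k h U ht (hsolv k hk h hh U)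
  have hsolT : ∀ k, k + 1 ≤ S.K → Hist.Admissible 𝔠.lane.carrier.M₁ (rcolOf S 𝔠.lane.carrier) (k + 1) (Hist.triv S.P (k + 1)) →
      ∀ (U : GaugeField S.P (k + 1) G),
        X.Uk k U ∈ admB42a 𝔊 𝔠 (k + 1) (Hist.triv S.P (k + 1)) (Vl (k + 1) (Hist.triv S.P (k + 1))) (Sm (k + 1) (Hist.triv S.P (k + 1)))
            (T (k + 1)) (Bk (k + 1) (Hist.triv S.P (k + 1))) U ∧
          IsMinOn A (admB42a 𝔊 𝔠 (k + 1) (Hist.triv S.P (k + 1)) (Vl (k + 1) (Hist.triv S.P (k + 1))) (Sm (k + 1) (Hist.triv S.P (k + 1)))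
            (T (k + 1)) (Bk (k + 1) (Hist.triv S.P (k + 1))) U) (X.Uk k U) :=
    fun k hk hh U => hminT k U (hsolv (k + 1) hk _ hh U)
  have h42 : ∀ k, k ≤ S.K → ∀ (h : Hist S.P k), Hist.Admissible 𝔠.lane.carrier.M₁ (rcolOf S 𝔠.lane.carrier) k h →
      ∀ (U : GaugeField S.P k G), ∃ V : ℕ → B7Prop1Explicit.Site S.P.d → Fin S.P.d → (Matrix (Fin 𝔊.N) (Fin 𝔊.N) ℂ)ˣ,
        HLarge S 𝔠.lane.carrier.b₀ 𝔠.lane.carrier.p₀ h V ∧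
          InB42Lift S 𝔠.lane.carrier.M₁ (rcolOf S 𝔠.lane.carrier) h (liftCfg 𝔊 (X.UkH k h U)) V := by
    intro k hk h hh U
    refine ⟨Vl k h, hVl k h, ?_⟩
    by_cases ht : h = Hist.triv S.P k
    · subst ht
      cases k with
      | zero => exact fun j hj => absurd hj (Nat.not_lt_zero j)
      | succ k =>
        rw [X.UkH_triv]
        exact (hmem hk (hsolT k hk hh U).1).1.2.1
    · exact (hmem hk (hsolN k hk h hh ht U).1).1.2.1
  exact ⟨X, hav, hreg, hm, hreg2, hsolN, hsolT, inEdgeFaces₃_of_inB42 𝔊 𝔠 X hm hreg2 h42⟩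
end Faces
end Summit.QuantumFields.YangMills.Theorems.BalabanUVNodesN08AlphaAdaptedSel

end
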